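/-
Copyright (c) 2026 the pub-hodgecm-mathlib formalisation cell (harness21).  Prover seat hodgecm-mathlib-K2E3-p03 (g7), HCML Track B «K2-LIT»,
h413 = `stmt-HodgeConjecture-24833`, road (11-3-split-nsc), leaf (nsc-S-A′), brick S2 (PEEL-LINKED, dealer D102) — generic preparations.  2026-09-04.
-/
import Literature.NumberTheory.Automorphic.ParabolicInductionQuotientProofs   -- ★ `Subrepresentation.quotientRep`, `quotientRep_mk`
import HarnessLib

/-!
# K2_E3 road (h413), leaf (nsc-S-A′), brick S2 (PEEL-LINKED) — generic preparations: the kernel ∕ image package of an intertwining map with the first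
# isomorphism `V ⁄ ker Φ ≃ im Φ`, and the character of a one-dimensional module pinned by a non-zero eigenfunctional

Cell `pub/hodgecm-mathlib` (D-0151), Track B, seat K2E3-p03 (g7) (dealer K2E3-plan (g4) D102; consumer K2E3-p17 (g8) S4).  `--supports stmt-HodgeConjecture-24833
--as helper`; THEOREMS ONLY (no `def`, no instance, no notation, no named fact, no `sorry`); never imports `Cruxes/…/Lines`.  COUNT-NEUTRAL.  These two lemmas keep the
big-typed proof of the linked peeling step (`K2E3GL3PeelLinked`) free of structure-building on concrete carriers (cf. the PERF NOTE of ★ `K2E3GL2JacquetPeelingStep`).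

* `exists_ker_range_package` — for an intertwining map `Φ : ρ → σ`: its kernel `K`, its image `N`, the corestriction `Φ_N : ρ ↠ N` (as data with `↑(Φ_N v) = Φ v`), and the FIRST
  ISOMORPHISM THEOREM `K.quotientRep ≃ N.toRepresentation` (Mathlib `LinearMap.quotKerEquivRange` made equivariant), all behind one `∃` (membership characterisations only).
* `forall_apply_eq_smul_of_finrank_eq_one` — a representation on a ONE-dimensional space acts by scalars, and a non-zero `χ`-eigenfunctional pins the scalars to `χ`.

HONEST LABEL: HC_CM is proved only modulo the 7 printed citations (2 remaining named inputs: hLiu418 = stmt-HodgeConjecture-24832, h413 = stmt-HodgeConjecture-24833) until rung 0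
closes; count-neutral generic helper.

## Mathlib ∕ tree search
Mathlib `Representation.IntertwiningMap.ker ∕ range ∕ mem_ker ∕ mem_range`, `Representation.Equiv.mk`, `LinearMap.quotKerEquivRange`, `LinearMap.quotKerEquivRange_apply_mk`,
`LinearMap.codRestrict`, `LinearMap.existsUnique_eq_smul_id_of_finrank_eq_one`; ★ `Subrepresentation.quotientRep ∕ quotientRep_mk` (ParabolicInductionQuotientProofs).
Dedup: `rg "ker_range_package|forall_apply_eq_smul_of_finrank_eq_one"` — no hits.

## References
* [BernsteinZelevinsky1976] I. N. Bernstein, A. V. Zelevinsky, *Representations of the group GL(n,F) where F is a non-archimedean local field*, Russian Math. Surveys 31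
  (1976), §2.1 (subquotients, first isomorphism theorem for representations).
* [Casselman1995] W. Casselman, *Introduction to the theory of admissible representations of p-adic reductive groups* (draft 1995), §4.4 p. 45 (one-dimensional weight spaces).
-/

set_option autoImplicit false
set_option linter.dupNamespace false

noncomputable section

open Function

namespace Summit.HodgeConjecture.HodgeConjecture.Cruxes.H413.K2E3GL3PeelLinkedPrep

/-! ## §1 Kernel, image, corestriction and the first isomorphism theorem of an intertwining map -/

/-- **THE KERNEL ∕ IMAGE PACKAGE OF AN INTERTWINING MAP** `Φ : ρ → σ`: a subrepresentation `K ≤ ρ` with `v ∈ K ↔ Φ v = 0`, a subrepresentation `N ≤ σ` with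
`w ∈ N ↔ ∃ v, Φ v = w`, the corestriction `Φ_N : ρ → N` (`↑(Φ_N v) = Φ v`, surjective), and the first isomorphism `ρ ⁄ K ≃ N` of representations.
[cite: BernsteinZelevinsky1976, §2.1] -/
theorem exists_ker_range_package {k G V W : Type*} [Field k] [Monoid G] [AddCommGroup V] [Module k V] [AddCommGroup W] [Module k W]
    {ρ : Representation k G V} {σ : Representation k G W} (Φ : ρ.IntertwiningMap σ) :
    ∃ (K : Subrepresentation ρ) (N : Subrepresentation σ) (ΦN : ρ.IntertwiningMap N.toRepresentation),
      (∀ v, v ∈ K ↔ Φ v = 0) ∧ (∀ w, w ∈ N ↔ ∃ v, Φ v = w) ∧ (∀ v, ((ΦN v : N.toSubmodule) : W) = Φ v) ∧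
      Function.Surjective ΦN ∧ Nonempty (K.quotientRep.Equiv N.toRepresentation) := by
  -- the corestriction
  let ΦN : ρ.IntertwiningMap Φ.range.toRepresentation :=
    { toLinearMap := LinearMap.codRestrict Φ.range.toSubmodule Φ.toLinearMap fun v => ⟨v, rfl⟩
      isIntertwining' := fun g => LinearMap.ext fun v => Subtype.ext (by
        simp only [LinearMap.coe_comp, Function.comp_apply, LinearMap.codRestrict_apply]
        exact Φ.isIntertwining _ _ g v) }
  have hΦN : ∀ v, ((ΦN v : Φ.range.toSubmodule) : W) = Φ v := fun v => rfl
  have hsurj : Function.Surjective ΦN := by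
    rintro ⟨w, v, hv⟩
    exact ⟨v, Subtype.ext hv⟩
  -- the first isomorphism theorem, made equivariant
  let e : (V ⧸ Φ.ker.toSubmodule) ≃ₗ[k] Φ.range.toSubmodule := Φ.toLinearMap.quotKerEquivRange
  have he : ∀ v : V, e (Submodule.Quotient.mk v) = ⟨Φ v, v, rfl⟩ := fun v => Subtype.ext (LinearMap.quotKerEquivRange_apply_mk Φ.toLinearMap v)
  have heq : ∀ g, (e : (V ⧸ Φ.ker.toSubmodule) →ₗ[k] Φ.range.toSubmodule) ∘ₗ (Φ.ker.quotientRep g) =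
      (Φ.range.toRepresentation g) ∘ₗ (e : (V ⧸ Φ.ker.toSubmodule) →ₗ[k] Φ.range.toSubmodule) := by
    intro g
    refine LinearMap.ext fun q => ?_
    induction q using Submodule.Quotient.induction_on with
    | H v =>
      rw [LinearMap.comp_apply, LinearMap.comp_apply, LinearEquiv.coe_coe, Subrepresentation.quotientRep_mk, he, he]
      refine Subtype.ext ?_
      change Φ (ρ g v) = σ g (Φ v)
      exact Φ.isIntertwining _ _ g v
  exact ⟨Φ.ker, Φ.range, ΦN, fun v => Representation.IntertwiningMap.mem_ker _ _ Φ v, fun w => Representation.IntertwiningMap.mem_range _ _ Φ w, hΦN, hsurj,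
    ⟨Representation.Equiv.mk e heq⟩⟩

/-! ## §2 One-dimensional modules: the character pinned by a non-zero eigenfunctional -/

/-- **A REPRESENTATION ON A ONE-DIMENSIONAL SPACE ACTS BY THE CHARACTER OF ANY NON-ZERO EIGENFUNCTIONAL**: if `finrank W = 1`, `E ≠ 0` is a linear form with
`E (τ m z) = χ m · E z`, then `τ m z = χ m • z` for all `m`, `z` (each `τ m` is a scalar `c_m` on the line `W`, and `c_m E z₀ = χ m E z₀` with `E z₀ ≠ 0`).
[cite: Casselman1995, §4.4 p. 45] -/
theorem forall_apply_eq_smul_of_finrank_eq_one {M W : Type*} [Monoid M] [AddCommGroup W] [Module ℂ W]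
    (τ : Representation ℂ M W) (h1 : Module.finrank ℂ W = 1) (χ : M → ℂ) (E : W →ₗ[ℂ] ℂ) (hE0 : E ≠ 0)
    (hE : ∀ m z, E (τ m z) = χ m * E z) : ∀ m z, τ m z = χ m • z := by
  obtain ⟨z₀, hz₀⟩ : ∃ z, E z ≠ 0 := by
    by_contra h
    push Not at h
    exact hE0 (LinearMap.ext h)
  intro m
  obtain ⟨c, hc, -⟩ := LinearMap.existsUnique_eq_smul_id_of_finrank_eq_one h1 (τ m)
  have hcm : c = χ m := by
    have h := hE m z₀
    rw [hc, LinearMap.smul_apply, LinearMap.id_apply, map_smul, smul_eq_mul] at h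
    exact mul_right_cancel₀ hz₀ h
  intro z
  rw [hc, LinearMap.smul_apply, LinearMap.id_apply, hcm]

/-! ## §3 A representation is equivalent to the image of an injective intertwining map -/

/-- **`ρ ≃ im Φ` for an injective intertwining map `Φ : ρ → σ`** (Mathlib `IntertwiningMap.ofBijective` on the corestriction). [cite: BernsteinZelevinsky1976, §2.1] -/
theorem nonempty_equiv_range_of_injective {k G V W : Type*} [Field k] [Monoid G] [AddCommGroup V] [Module k V] [AddCommGroup W] [Module k W]
    {ρ : Representation k G V} {σ : Representation k G W} (Φ : ρ.IntertwiningMap σ) (hΦ : Function.Injective Φ) :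
    Nonempty (ρ.Equiv Φ.range.toRepresentation) := by
  let ΦN : ρ.IntertwiningMap Φ.range.toRepresentation :=
    { toLinearMap := LinearMap.codRestrict Φ.range.toSubmodule Φ.toLinearMap fun v => ⟨v, rfl⟩
      isIntertwining' := fun g => LinearMap.ext fun v => Subtype.ext (by
        simp only [LinearMap.coe_comp, Function.comp_apply, LinearMap.codRestrict_apply]
        exact Φ.isIntertwining _ _ g v) }
  refine ⟨ΦN.ofBijective ⟨fun v w h => hΦ (congrArg Subtype.val h), ?_⟩⟩
  rintro ⟨w, v, hv⟩
  exact ⟨v, Subtype.ext hv⟩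

end Summit.HodgeConjecture.HodgeConjecture.Cruxes.H413.K2E3GL3PeelLinkedPrep

end
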